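import Summits.BirchSwinnertonDyer.BirchSwinnertonDyer.Theorems.UniversalToricDescentLocalH1Count
import Literature.NumberTheory.GaloisRepresentations.LocalFieldCdTwo
import Literature.NumberTheory.GaloisRepresentations.LocalGaloisGroupFrobeniusProofs
import Mathlib.NumberTheory.Padics.RingHoms
import HarnessLib

/-!
# Route UniversalToricDescent — Greenberg–Vatsal Prop. (2.4), the Frobenius reduction:
# a subgroup `S ⊇ I_{K_v}` of `Γ_{K_v}` that is open "uniformly" contains `Gal(K̄_v/K_{∞,w})`
# iff it contains `φ^{p^R}` (`φ` an arithmetic Frobenius, `R ≫ 0`)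

Lead prover bsd-wall-utd-p1 g9 (`--supports stmt-BirchSwinnertonDyer-20399`; sequel of
`UniversalToricDescentLocalH1Count`, memo ALG-HALF-21845-LOCAL §3/§5). For a number field `K`, a
`ℤ_p`-extension `κ` and a place `v ∤ p` NOT split completely in `K_∞`, write `Γ = Γ_{K_v}`,
`λ = κ ∘ res : Γ → ℤ_p` (additively), `Hi = ker λ = Gal(K̄_v/K_{∞,w})`, `I = I_{K_v} ≤ Hi`, and let
`φ ∈ Γ` be an arithmetic Frobenius (`IsFrobPow φ 1`). The invariants of `Hi` on a finite `Γ`-set on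
which `I` and an open normal `N₀` act trivially are the invariants of the single element `φ^{p^R}`
(`R ≫ 0`): this is the step "`G_{(ℚ_∞)_η}/I_η` is topologically generated by (a `p`-power of)
Frobenius, up to a pro-prime-to-`p` group" of the proof of [GreenbergVatsal2000] Prop. (2.4), in the
form the counting of `H¹(K_{∞,w}, E[p]) = Hom(I, E[p])^{Hi}` needs.

* `toAdd_apply_frob_ne_zero` — `λ(φ) ≠ 0` (else `λ ≡ 0`, contradicting `hns`; Frobenius generates `Γ/U`
  for every open normal `U ⊇ I`, the tree's `exists_pow_eq_mk`).
* `mul_mem_of_isClosed_of_forall_natCast_mul_mem` — a closed subset of `ℤ_p` stable under `ℕ`-multiples of `x` contains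
  `ℤ_p · x` (density of `ℕ` in `ℤ_p`).
* **`exists_forall_localSubgroup_le_iff_pow_mem`** — for every open normal `N₀ ≤ Γ` there is `R₀`
  such that for all `R ≥ R₀` and every subgroup `S ≤ Γ` containing `I` and `N₀`:
  **`Hi ≤ S ↔ φ^{p^R} ∈ S`**. (`⇐`: modulo the open normal `(N₀ ∩ λ⁻¹(p^n ℤ_p))·I` every `h ∈ Hi`
  is `φ^i u` with `λ(u) ∈ p^n ℤ_p`, so `p^R ∣ i` once `n > R + v_p(λ φ)`; `⇒`: `λ(N₀ I)` is closed and
  contains `e·λ(φ)`, `e = #(Γ/N₀I)`, hence `p^R λ(φ)` for `p^R ∈ e ℤ_p`, i.e. `φ^{p^R} ∈ Hi·N₀I`.)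

THEOREMS ONLY; no definition, no named fact, no `sorry`. BSD is not advanced by this file.
References: [GreenbergVatsal2000] §2, proof of Prop. (2.4) (p. 22); [GreenbergLNM1716] §3 (p. 87);
[SerreLocalFields1979] IV §4, XIII §4; [TateCorvallis1979] (1.4.1).
-/

set_option autoImplicit false
-- `…BirchSwinnertonDyer.BirchSwinnertonDyer.Theorems…` is the problem's mandated namespace (D-0017).
set_option linter.dupNamespace false

noncomputable section

open scoped Classical

namespace Summit.BirchSwinnertonDyer.BirchSwinnertonDyer.Theorems.UniversalToricDescentFrobeniusReduction

open NumberField IsDedekindDomain Field ValuativeRel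
open Literature.NumberTheory.EllipticCurves Literature.NumberTheory.GaloisRepresentations
  Literature.NumberTheory.GaloisRepresentations.IsNonarchimedeanLocalField
  IsDedekindDomain.HeightOneSpectrum
  Summit.BirchSwinnertonDyer.BirchSwinnertonDyer.Theorems.UniversalToricDescentLocalH1Count

/-! ### §0 Two facts about `ℤ_p` -/

section Padic

variable {p : ℕ} [Fact p.Prime]

/-- **A closed subset of `ℤ_p` containing all natural multiples `n · x` contains `t · x` for every
`t ∈ ℤ_p`** (the naturals are dense in `ℤ_p`). [folklore] -/
theorem mul_mem_of_isClosed_of_forall_natCast_mul_mem {C : Set ℤ_[p]} (hC : IsClosed C) {x : ℤ_[p]}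
    (hx : ∀ n : ℕ, (n : ℤ_[p]) * x ∈ C) (t : ℤ_[p]) : t * x ∈ C := by
  have hS : IsClosed {t : ℤ_[p] | t * x ∈ C} := hC.preimage (continuous_id.mul continuous_const)
  have hsub : Set.range (Nat.cast : ℕ → ℤ_[p]) ⊆ {t : ℤ_[p] | t * x ∈ C} := by
    rintro _ ⟨n, rfl⟩
    exact hx n
  have h : closure (Set.range (Nat.cast : ℕ → ℤ_[p])) ⊆ {t : ℤ_[p] | t * x ∈ C} :=
    hS.closure_subset_iff.mpr hsub
  rw [PadicInt.denseRange_natCast.closure_range] at h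
  exact h (Set.mem_univ t)

/-- If `p^n ∣ i · μ` in `ℤ_p` with `μ ≠ 0` of valuation `m ≤ n`, then `p^{n-m} ∣ i`. [folklore] -/
theorem pow_dvd_of_pow_dvd_natCast_mul {μ : ℤ_[p]} (hμ : μ ≠ 0) {n : ℕ} (hmn : μ.valuation ≤ n)
    {i : ℕ} (h : (p : ℤ_[p]) ^ n ∣ (i : ℤ_[p]) * μ) : p ^ (n - μ.valuation) ∣ i := by
  have hp : (p : ℕ).Prime := Fact.out
  have hnorm : ‖(i : ℤ_[p]) * μ‖ ≤ (p : ℝ) ^ (-(n : ℤ)) :=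
    (PadicInt.norm_le_pow_iff_mem_span_pow _ n).2 (Ideal.mem_span_singleton.2 h)
  rw [norm_mul, PadicInt.norm_eq_zpow_neg_valuation hμ] at hnorm
  have hp1 : (1 : ℝ) < p := by exact_mod_cast hp.one_lt
  have hi : ‖((i : ℤ) : ℤ_[p])‖ ≤ (p : ℝ) ^ (-((n - μ.valuation : ℕ) : ℤ)) := by
    rw [Int.cast_natCast]
    have hpow : (0 : ℝ) < (p : ℝ) ^ (-(μ.valuation : ℤ)) := zpow_pos (by exact_mod_cast hp.pos) _
    rw [← le_div_iff₀ hpow] at hnorm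
    refine hnorm.trans (le_of_eq ?_)
    rw [← zpow_sub₀ (by exact_mod_cast hp.ne_zero), Nat.cast_sub hmn]
    congr 1
    ring
  have hdvd : ((p : ℤ) ^ (n - μ.valuation)) ∣ (i : ℤ) := PadicInt.norm_int_le_pow_iff_dvd.1 hi
  exact_mod_cast hdvd

end Padic

/-! ### §1 The local character and the Frobenius -/

variable {K : Type} [Field K] [NumberField K] {v : HeightOneSpectrum (𝓞 K)} {p : ℕ} [Fact p.Prime]
  (κ : ZpExtension K p)

/-- **`λ(φ) ≠ 0` for an arithmetic Frobenius `φ` at a place not split completely in `K_∞`**, where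
`λ = κ ∘ res`: otherwise `λ` vanishes on `φ^i U` for every open normal `U ⊇ I_{K_v}` inside a layer
subgroup, hence everywhere (`exists_pow_eq_mk`), contradicting `hns`. [cite: GreenbergLNM1716, §3 (p. 87)] -/
theorem toAdd_apply_frob_ne_zero (hpv : (p : 𝓞 K) ∉ v.asIdeal)
    (hns : ∃ σ : absoluteGaloisGroup (v.adicCompletion K),
      σ ∉ localSubgroup κ.kerSubgroup (v.adicCompletion K))
    {φ : absoluteGaloisGroup (v.adicCompletion K)} (hφ : IsFrobPow φ 1) :
    (κ (resGal (K := K) (v.adicCompletion K) φ)).toAdd ≠ 0 := by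
  -- notation
  let G : Type := absoluteGaloisGroup (v.adicCompletion K)
  let lam : G → ℤ_[p] := fun x ↦ (κ (resGal (K := K) (v.adicCompletion K) x)).toAdd
  have hlam_mul : ∀ x y : G, lam (x * y) = lam x + lam y := fun x y ↦ by
    show (κ (resGal (K := K) _ (x * y))).toAdd = _
    rw [map_mul, map_mul, toAdd_mul]
  have hlam_inv : ∀ x : G, lam x⁻¹ = -lam x := fun x ↦ by
    show (κ (resGal (K := K) _ x⁻¹)).toAdd = _
    rw [map_inv, map_inv, toAdd_inv]
  have hlam_pow : ∀ (x : G) (n : ℕ), lam (x ^ n) = (n : ℤ_[p]) * lam x := fun x n ↦ by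
    show (κ (resGal (K := K) _ (x ^ n))).toAdd = (n : ℤ_[p]) * (κ (resGal (K := K) _ x)).toAdd
    rw [map_pow, map_pow, toAdd_pow, nsmul_eq_mul]
  haveI := absoluteGaloisGroup_compactSpace (v.adicCompletion K)
  intro h0
  obtain ⟨σ₀, hσ₀⟩ := hns
  apply hσ₀
  rw [mem_localSubgroup_iff, ZpExtension.mem_kerSubgroup]
  apply Multiplicative.toAdd.injective
  rw [toAdd_one]
  -- an element of `ℤ_p` divisible by every power of `p` is `0`
  by_contra hx
  have hpos : 0 < ‖(κ (resGal (K := K) (v.adicCompletion K) σ₀)).toAdd‖ := norm_pos_iff.2 hx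
  obtain ⟨n, hk⟩ := PadicInt.exists_pow_neg_lt p hpos
  refine lt_irrefl _ (hk.trans_le ((PadicInt.norm_le_pow_iff_mem_span_pow _ n).2
    (Ideal.mem_span_singleton.2 ?_)))
  -- the open normal layer subgroup `L_n ⊇ I`
  let L : Subgroup G := localSubgroup (κ.layerSubgroup n) (v.adicCompletion K)
  haveI : L.Normal := Subgroup.Normal.comap inferInstance _
  have hLopen : IsOpen (L : Set G) := isOpen_localSubgroup_layerSubgroup (v.adicCompletion K) κ n
  have hIL : absInertia (v.adicCompletion K) ≤ L := fun x hx ↦ by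
    have hx' := absInertia_le_localSubgroup κ hpv hx
    rw [mem_localSubgroup_iff, ZpExtension.mem_kerSubgroup] at hx'
    rw [mem_localSubgroup_iff, ZpExtension.mem_layerSubgroup, hx', toAdd_one]
    exact dvd_zero _
  obtain ⟨i, hi⟩ := exists_pow_eq_mk (v.adicCompletion K) hLopen hIL hφ (QuotientGroup.mk σ₀)
  rw [← QuotientGroup.mk_pow, QuotientGroup.eq] at hi
  -- `λ(σ₀⁻¹ φ^i) = -λ σ₀` is divisible by `p^n`
  have hmem := (mem_localSubgroup_iff _ _ _).mp hi
  rw [ZpExtension.mem_layerSubgroup] at hmem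
  have hval : (κ (resGal (K := K) (v.adicCompletion K) (σ₀⁻¹ * φ ^ i))).toAdd = -lam σ₀ := by
    show lam (σ₀⁻¹ * φ ^ i) = -lam σ₀
    rw [hlam_mul, hlam_inv, hlam_pow]
    show -lam σ₀ + (i : ℤ_[p]) * (κ (resGal (K := K) (v.adicCompletion K) φ)).toAdd = -lam σ₀
    rw [h0, mul_zero, add_zero]
  rw [hval] at hmem
  exact (dvd_neg.mp hmem)

/-- **The Frobenius reduction.** Let `v ∤ p` be not split completely in the `ℤ_p`-extension `κ`,
`Hi = Gal(K̄_v/K_{∞,w})`, `I = I_{K_v}` and `φ` an arithmetic Frobenius of `K_v`. For every open normal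
subgroup `N₀ ≤ Γ_{K_v}` there is `R₀` such that for all `R ≥ R₀` and every subgroup `S ≤ Γ_{K_v}`
containing `I` and `N₀`: **`Hi ≤ S ↔ φ^{p^R} ∈ S`**. (The typical `S` is the stabiliser, in a finite
`Γ_{K_v}`-set with `I` and `N₀` acting trivially, of a point; e.g. a continuous homomorphism
`I → E[p]` under conjugation-twisted action.) [cite: GreenbergVatsal2000, §2 Prop. (2.4) (proof, p. 22)]
[cite: SerreLocalFields1979, XIII §4] -/
theorem exists_forall_localSubgroup_le_iff_pow_mem (hpv : (p : 𝓞 K) ∉ v.asIdeal)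
    (hns : ∃ σ : absoluteGaloisGroup (v.adicCompletion K),
      σ ∉ localSubgroup κ.kerSubgroup (v.adicCompletion K))
    {φ : absoluteGaloisGroup (v.adicCompletion K)} (hφ : IsFrobPow φ 1)
    (N₀ : Subgroup (absoluteGaloisGroup (v.adicCompletion K))) [N₀.Normal]
    (hN₀ : IsOpen (N₀ : Set (absoluteGaloisGroup (v.adicCompletion K)))) :
    ∃ R₀ : ℕ, ∀ R : ℕ, R₀ ≤ R → ∀ S : Subgroup (absoluteGaloisGroup (v.adicCompletion K)),
      absInertia (v.adicCompletion K) ≤ S → N₀ ≤ S →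
        (localSubgroup κ.kerSubgroup (v.adicCompletion K) ≤ S ↔ φ ^ p ^ R ∈ S) := by
  -- notation and the local character
  let G : Type := absoluteGaloisGroup (v.adicCompletion K)
  let Hi : Subgroup G := localSubgroup κ.kerSubgroup (v.adicCompletion K)
  let I : Subgroup G := absInertia (v.adicCompletion K)
  let lam : G → ℤ_[p] := fun x ↦ (κ (resGal (K := K) (v.adicCompletion K) x)).toAdd
  have hlam_mul : ∀ x y : G, lam (x * y) = lam x + lam y := fun x y ↦ by
    show (κ (resGal (K := K) _ (x * y))).toAdd = _
    rw [map_mul, map_mul, toAdd_mul]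
  have hlam_inv : ∀ x : G, lam x⁻¹ = -lam x := fun x ↦ by
    show (κ (resGal (K := K) _ x⁻¹)).toAdd = _
    rw [map_inv, map_inv, toAdd_inv]
  have hlam_pow : ∀ (x : G) (n : ℕ), lam (x ^ n) = (n : ℤ_[p]) * lam x := fun x n ↦ by
    show (κ (resGal (K := K) _ (x ^ n))).toAdd = (n : ℤ_[p]) * (κ (resGal (K := K) _ x)).toAdd
    rw [map_pow, map_pow, toAdd_pow, nsmul_eq_mul]
  have hlam_cont : Continuous lam :=
    continuous_toAdd.comp ((map_continuous κ).comp (map_continuous (resGal (K := K) _)))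
  have hlam_Hi : ∀ x : G, x ∈ Hi ↔ lam x = 0 := fun x ↦ by
    show x ∈ localSubgroup κ.kerSubgroup (v.adicCompletion K) ↔ _
    rw [mem_localSubgroup_iff, ZpExtension.mem_kerSubgroup]
    constructor
    · intro h
      show (κ (resGal (K := K) _ x)).toAdd = 0
      rw [h, toAdd_one]
    · intro h
      exact Multiplicative.toAdd.injective (by rw [toAdd_one]; exact h)
  have hle : I ≤ Hi := absInertia_le_localSubgroup κ hpv
  have hlam_I : ∀ x ∈ I, lam x = 0 := fun x hx ↦ (hlam_Hi x).mp (hle hx)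
  haveI := absoluteGaloisGroup_compactSpace (v.adicCompletion K)
  haveI hIn : I.Normal := absInertia_normal_holds (v.adicCompletion K)
  -- `μ = λ φ ≠ 0`, of valuation `m`
  set μ : ℤ_[p] := lam φ with hμdef
  have hμ : μ ≠ 0 := toAdd_apply_frob_ne_zero κ hpv hns hφ
  set m : ℕ := μ.valuation with hmdef
  -- the open normal `U = N₀ · I ⊇ I`, the finite quotient `Γ/U` and its order `e`
  let U : Subgroup G := N₀ ⊔ I
  haveI : U.Normal := Subgroup.sup_normal N₀ I
  have hUopen : IsOpen (U : Set G) := Subgroup.isOpen_mono (le_sup_left : N₀ ≤ U) hN₀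
  have hIU : I ≤ U := le_sup_right
  haveI : Finite (G ⧸ U) := Subgroup.quotient_finite_of_isOpen U hUopen
  letI : Fintype (G ⧸ U) := Fintype.ofFinite _
  set e : ℕ := Fintype.card (G ⧸ U) with hedef
  have hepos : 0 < e := Fintype.card_pos
  have he0 : (e : ℤ_[p]) ≠ 0 := by exact_mod_cast hepos.ne'
  have hpow_mem : ∀ g : G, g ^ e ∈ U := fun g ↦ by
    rw [← QuotientGroup.eq_one_iff, QuotientGroup.mk_pow, hedef, pow_card_eq_one]
  -- `λ(U)` is closed and contains `t • e μ` for all `t ∈ ℤ_p`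
  have hUcl : IsClosed (lam '' (U : Set G)) :=
    ((Subgroup.isClosed_of_isOpen U hUopen).isCompact.image hlam_cont).isClosed
  have hmult : ∀ t : ℤ_[p], t * ((e : ℤ_[p]) * μ) ∈ lam '' (U : Set G) := by
    refine mul_mem_of_isClosed_of_forall_natCast_mul_mem hUcl fun n ↦ ?_
    refine ⟨(φ ^ e) ^ n, U.pow_mem (hpow_mem φ) n, ?_⟩
    show lam ((φ ^ e) ^ n) = _
    rw [hlam_pow, hlam_pow]
  -- the bound `R₀ = v_p(e)`
  refine ⟨(e : ℤ_[p]).valuation, fun R hR S hIS hN₀S ↦ ?_⟩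
  have hUS : U ≤ S := sup_le hN₀S hIS
  constructor
  · -- `Hi ≤ S ⟹ φ^{p^R} ∈ S`: find `u ∈ U` with `λ u = p^R μ`
    intro hHiS
    obtain ⟨u, huU, hu⟩ : ∃ u ∈ (U : Set G), lam u = ((p : ℤ_[p]) ^ R) * μ := by
      have h := hmult ((p : ℤ_[p]) ^ (R - (e : ℤ_[p]).valuation) *
        ↑(PadicInt.unitCoeff he0)⁻¹)
      have heq : (p : ℤ_[p]) ^ (R - (e : ℤ_[p]).valuation) * ↑(PadicInt.unitCoeff he0)⁻¹ *
          ((e : ℤ_[p]) * μ) = (p : ℤ_[p]) ^ R * μ := by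
        have hspec : (e : ℤ_[p]) * μ =
            ↑(PadicInt.unitCoeff he0) * (p : ℤ_[p]) ^ (e : ℤ_[p]).valuation * μ := by
          rw [← PadicInt.unitCoeff_spec he0]
        rw [hspec, show (p : ℤ_[p]) ^ R = (p : ℤ_[p]) ^ (R - (e : ℤ_[p]).valuation) *
          (p : ℤ_[p]) ^ (e : ℤ_[p]).valuation by rw [← pow_add, Nat.sub_add_cancel hR]]
        calc (p : ℤ_[p]) ^ (R - (e : ℤ_[p]).valuation) * ↑(PadicInt.unitCoeff he0)⁻¹ *
              (↑(PadicInt.unitCoeff he0) * (p : ℤ_[p]) ^ (e : ℤ_[p]).valuation * μ)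
            = (p : ℤ_[p]) ^ (R - (e : ℤ_[p]).valuation) *
                (↑(PadicInt.unitCoeff he0)⁻¹ * ↑(PadicInt.unitCoeff he0)) *
                (p : ℤ_[p]) ^ (e : ℤ_[p]).valuation * μ := by ring
          _ = _ := by rw [Units.inv_mul, mul_one, mul_assoc]
      rw [heq] at h
      obtain ⟨u, hu, hlu⟩ := h
      exact ⟨u, hu, hlu⟩
    -- `h = φ^{p^R} u⁻¹ ∈ Hi`
    have hh : φ ^ p ^ R * u⁻¹ ∈ Hi := by
      rw [hlam_Hi, hlam_mul, hlam_inv, hlam_pow, hu]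
      push_cast
      ring
    have : φ ^ p ^ R = φ ^ p ^ R * u⁻¹ * u := by rw [inv_mul_cancel_right]
    rw [this]
    exact S.mul_mem (hHiS hh) (hUS huU)
  · -- `φ^{p^R} ∈ S ⟹ Hi ≤ S`
    intro hφS h hh
    -- the finer open normal `U' = (N₀ ∩ L_n) · I` with `n = R + m + 1`
    set n : ℕ := R + m + 1 with hndef
    let L : Subgroup G := localSubgroup (κ.layerSubgroup n) (v.adicCompletion K)
    haveI : L.Normal := Subgroup.Normal.comap inferInstance _
    have hLopen : IsOpen (L : Set G) := isOpen_localSubgroup_layerSubgroup (v.adicCompletion K) κ n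
    have hlam_L : ∀ x : G, x ∈ L ↔ (p : ℤ_[p]) ^ n ∣ lam x := fun x ↦ by
      show x ∈ localSubgroup (κ.layerSubgroup n) (v.adicCompletion K) ↔ _
      rw [mem_localSubgroup_iff, ZpExtension.mem_layerSubgroup]
    let N' : Subgroup G := N₀ ⊓ L
    haveI : N'.Normal := inferInstance
    let U' : Subgroup G := N' ⊔ I
    haveI : U'.Normal := Subgroup.sup_normal N' I
    have hU'open : IsOpen (U' : Set G) :=
      Subgroup.isOpen_mono (le_sup_left : N' ≤ U') (hN₀.inter hLopen)
    have hIU' : I ≤ U' := le_sup_right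
    obtain ⟨i, hi⟩ := exists_pow_eq_mk (v.adicCompletion K) hU'open hIU' hφ (QuotientGroup.mk h)
    rw [← QuotientGroup.mk_pow, QuotientGroup.eq] at hi
    -- `h⁻¹ φ^i = n' τ` with `n' ∈ N₀ ∩ L`, `τ ∈ I`
    have hi' : (h⁻¹ * φ ^ i : G) ∈ ((U' : Subgroup G) : Set G) := hi
    rw [Subgroup.normal_mul] at hi'
    obtain ⟨n', hn', τ, hτ, hprod⟩ := Set.mem_mul.mp hi'
    have hn'N : n' ∈ N₀ := (Subgroup.mem_inf.mp hn').1
    have hn'L : (p : ℤ_[p]) ^ n ∣ lam n' := (hlam_L n').mp (Subgroup.mem_inf.mp hn').2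
    -- `λ(h) = 0` forces `p^n ∣ i μ`
    have hdiv : (p : ℤ_[p]) ^ n ∣ (i : ℤ_[p]) * μ := by
      have h1 : lam (h⁻¹ * φ ^ i) = lam n' := by
        rw [← hprod, hlam_mul n' τ, hlam_I τ hτ, add_zero]
      rw [hlam_mul, hlam_inv, (hlam_Hi h).mp hh, neg_zero, zero_add, hlam_pow] at h1
      rw [h1]
      exact hn'L
    have hmn : m ≤ n := by omega
    have hpi : p ^ (n - m) ∣ i := pow_dvd_of_pow_dvd_natCast_mul hμ hmn hdiv
    have hRle : R ≤ n - m := by omega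
    obtain ⟨j, hj⟩ : p ^ R ∣ i := (pow_dvd_pow p hRle).trans hpi
    -- assemble: `h = φ^i (n' τ)⁻¹`
    have hφi : φ ^ i ∈ S := by
      rw [hj, pow_mul]
      exact S.pow_mem hφS j
    have hnt : n' * τ ∈ S := S.mul_mem (hN₀S hn'N) (hIS hτ)
    have heq : h = φ ^ i * (n' * τ)⁻¹ := by
      rw [hprod, mul_inv_rev, inv_inv, ← mul_assoc, mul_inv_cancel, one_mul]
    rw [heq]
    exact S.mul_mem hφi (S.inv_mem hnt)

end Summit.BirchSwinnertonDyer.BirchSwinnertonDyer.Theorems.UniversalToricDescentFrobeniusReduction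

end
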